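/-
Copyright (c) 2026. All rights reserved.
Released under Apache 2.0 license as described in the file LICENSE.
-/
import Mathlib
import HarnessLib
import Summits.Ventures.LatticeQCDFlow.Scaling.MDSpecialUnitaryCollar
import Summits.Ventures.LatticeQCDFlow.Scaling.MDLeapfrog
import Summits.Ventures.LatticeQCDFlow.Exactness.SplittingIntegrator
import Summits.Ventures.LatticeQCDFlow.Exactness.MomentumRefresh

/-!
# The `SU(N)` gauge leapfrog HMC kernel is EXACT and obeys the SECTOR tunnelling law
# (lean-1 GEN-7, own work)

HONEST FRAMING: exact (Metropolis-corrected) sampling algorithms for lattice gauge theory;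
figures of merit are autocorrelation/cost numbers at stated couplings and volumes; no
continuum-physics claim.

Venture `LatticeQCDFlow` (cell pub-lqcd), topic `Scaling`, FANOUT row 30 (lean-1).  NEW WORK of the
cell; nothing here is cited as a fact.  The `SU(N)` counterpart of theory2's item 116c
(`Scaling/MDLeapfrog`, compact `U(1)`): the proposal `flip * leapfrog (mulDrift (halfExp δ)) g ^ n`
of the tree's `Exactness/SplittingIntegrator` — `n` steps `drift(δ/2) ∘ kick ∘ drift(δ/2)` with the
gauge-link drift `U_e ↦ exp((δ/2)·π_e)·U_e` (`π : E → 𝔰𝔲(N)`, the tree's chart `SUN.suChart`), any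
measurable force `g`, momentum flip — is, as a map, `flip ∘ MD.nodes (lfStep …) (3n)` (item 116c's
`MD.coe_leapfrog_pow_eq_nodes`), and its drift nodes are the `SU(N)` MD drifts of
`Scaling/MDSpecialUnitaryCollar` (`lfStep_halfExp_fst`).  Hence, for every `N`, `d`, `L ≥ 1`:
* **`sun_leapfrogHMC_sectorCharge_ne_le_sum`** — for every left-invariant s-finite `volU` on
  `SU(N)^E`, translation-invariant s-finite `volP` on `𝔰𝔲(N)^E`, measurable `S`, `T` with
  `0 < Z_T < ∞`, measurable `g`, `δ`, `n`, `h`, every admissible region `A ⊇ {all plaquettes within ε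
  of 1}` and every measurable `Q` constant on the connected components of `A`:
  `(e^{−S}volU ⊗ K){Q ≠ Q'} ≤ Z_T⁻¹ Σ_{k<3n} (e^{h}·B{z | ∃ p, ε − |δ/2|·Σ_{e∈∂p}‖(lfField k z)_e‖ ≤ dist((z.1)_p, 1)} + B{ΔH_k > h})`
  (`SUN.sun_hmc_sectorCharge_ne_le_sum` with the leapfrog schedule; the kick nodes have zero field);
* **`sun_leapfrogHMC_exact`** — the SAME kernel leaves `e^{−S}volU` invariant when `volP` is also
  negation-invariant (`Exactness.hmc_config_exact` + `SplittingIntegrator`, time reversal from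
  `halfExp_neg : halfExp δ (−π) = (halfExp δ π)⁻¹`, i.e. `exp(−X) = exp(X)ᴴ` for skew-Hermitian `X`).
One kernel, two theorems: exact at every `(δ, n)`, and per update at stationarity it changes the
`ε`-sector at most as often as some drift node has a plaquette within its momentum margin of the
admissibility cut (×`e^{h}`) or some node violates energy by more than `h`.  NOT CLAIMED: any
estimate of those masses; the value of the constant `r₀(N)` of Lüscher's sectors; anything numerical.
Two `def`s (`SUN.halfExp`, `SUN.lfField`); no `sorry`; standard axioms only.
-/

noncomputable section

open scoped Matrix.Norms.Frobenius Matrix ENNReal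
open MeasureTheory Metric Set Filter Topology NormedSpace ProbabilityTheory
open Literature.MathematicalPhysics.QuantumFieldTheory
open Literature.MathematicalPhysics.QuantumFieldTheory.UnitaryCayley (𝔼 skewOf conjTranspose_skewOf)
open Summit.Ventures.LatticeQCDFlow.Exactness
open Summit.Ventures.LatticeQCDFlow.Theory2.Tunnelling

namespace Summit.Ventures.LatticeQCDFlow.Theory2.Lattice.SUN

variable {N d L : ℕ}

/-! ## §1 The half-step exponential on `SU(N)` and its time reversal -/

/-- `suChart (−a) = (suChart a)⁻¹`: `exp(−X) = exp(Xᴴ) = (exp X)ᴴ` for skew-Hermitian `X`. [folklore] -/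
theorem suChart_neg (a : suAlg N) : suChart (-a) = (suChart a)⁻¹ := by
  apply Subtype.ext
  show exp (skewOf ((-a : suAlg N) : 𝔼 N)) = (exp (skewOf (a : 𝔼 N)))ᴴ
  rw [Submodule.coe_neg, map_neg, ← conjTranspose_skewOf, Matrix.exp_conjTranspose]

/-- The half-step exponential of `SU(N)` gauge-link leapfrog: `π ↦ (e ↦ exp((δ/2)·π_e))`. [folklore] -/
def halfExp (δ : ℝ) (p : Edge d L → suAlg N) : GaugeConfig d L (Matrix.specialUnitaryGroup (Fin N) ℂ) :=
  fun e => suChart ((δ / 2) • p e)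

/-- The time-reversal law `e(−π) = e(π)⁻¹` of the half-step exponential. [folklore] -/
theorem halfExp_neg (δ : ℝ) (p : Edge d L → suAlg N) : halfExp δ (-p) = (halfExp δ p)⁻¹ := by
  funext e
  simp only [halfExp, Pi.neg_apply, smul_neg, suChart_neg, Pi.inv_apply]

/-- The half-step exponential is measurable (it is continuous). [folklore] -/
theorem measurable_halfExp [NeZero L] (δ : ℝ) : Measurable (halfExp (N := N) (d := d) (L := L) δ) := by
  refine Continuous.measurable (continuous_pi fun e => ?_)
  exact continuous_suChart.comp ((continuous_apply e).const_smul (δ / 2))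

/-- The driving field of node `k` of the leapfrog schedule: the momenta at the drifts, zero at the
kick. [folklore] -/
def lfField (k : ℕ) (z : GaugeConfig d L (Matrix.specialUnitaryGroup (Fin N) ℂ) × (Edge d L → suAlg N)) :
    Edge d L → suAlg N :=
  if k % 3 = 1 then 0 else z.2

/-- The driving fields are measurable. [folklore] -/
theorem measurable_lfField [NeZero L] (k : ℕ) : Measurable (lfField (N := N) (d := d) (L := L) k) := by
  unfold lfField
  split_ifs
  · exact measurable_const
  · exact measurable_snd

/-- A drift by the zero field is the identity. [folklore] -/
theorem drift_zero_field (t : ℝ) (U : GaugeConfig d L (Matrix.specialUnitaryGroup (Fin N) ℂ)) :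
    drift t (0 : Edge d L → suAlg N) U = U := by
  funext e; simp [drift, suChart_zero]

/-- **The leapfrog drift nodes are the `SU(N)` MD drifts of the collar file**: step `k` of the
schedule moves the configuration by `drift (δ/2) (lfField k z)`. [folklore] -/
theorem lfStep_halfExp_fst (δ : ℝ)
    (g : GaugeConfig d L (Matrix.specialUnitaryGroup (Fin N) ℂ) → (Edge d L → suAlg N)) (k : ℕ)
    (z : GaugeConfig d L (Matrix.specialUnitaryGroup (Fin N) ℂ) × (Edge d L → suAlg N)) :
    (MD.lfStep (Exactness.mulDrift (halfExp δ)) g k z).1 = drift (δ / 2) (lfField k z) z.1 := by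
  rw [MD.lfStep_mulDrift_fst]
  unfold lfField
  split_ifs
  · rw [drift_zero_field]
  · rfl

/-! ## §2 The `SU(N)` leapfrog HMC kernel: the sector tunnelling law, and exactness -/

section Law

variable [NeZero L]

/-- **THE ENGINE-SHAPED `SU(N)` LEAPFROG HMC OBEYS THE SECTOR TUNNELLING LAW.**  `volU` any
left-invariant s-finite measure on `SU(N)^E`, `volP` any translation-invariant s-finite measure on
`𝔰𝔲(N)^E`, ANY measurable action `S`, kinetic term `T` with `0 < Z_T < ∞`, ANY measurable force `g`,
step size `δ`, `n` leapfrog steps, momentum flip, Metropolis filter on `H = S + T`; `A` any admissible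
region containing every configuration all of whose plaquettes are within `ε` of `1`, `Q` any
measurable observable constant on the connected components of `A`.  Per update at stationarity and
for every `h : ℝ`:
`(e^{-S}volU ⊗ K){Q ≠ Q'} ≤ Z_T⁻¹ Σ_{k<3n} (e^{h}·B{z | ∃ p, ε − |δ/2|·Σ_{e∈∂p}‖(lfField k z)_e‖ ≤ dist ((z.1)_p) 1} + B{ΔH_k > h})`,
`B = e^{-(S+T)}(volU ⊗ volP)`. [folklore] -/
theorem sun_leapfrogHMC_sectorCharge_ne_le_sum {ε : ℝ}
    {A : Set (GaugeConfig d L (Matrix.specialUnitaryGroup (Fin N) ℂ))}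
    (hA : ∀ V : GaugeConfig d L (Matrix.specialUnitaryGroup (Fin N) ℂ),
      (∀ x μ ν, dist (plaquetteHolonomy V x μ ν) 1 < ε) → V ∈ A)
    {Q : GaugeConfig d L (Matrix.specialUnitaryGroup (Fin N) ℂ) → ℝ} (hQ : Measurable Q)
    (hQA : ∀ U V : GaugeConfig d L (Matrix.specialUnitaryGroup (Fin N) ℂ),
      V ∈ connectedComponentIn A U → Q V = Q U)
    (volU : Measure (GaugeConfig d L (Matrix.specialUnitaryGroup (Fin N) ℂ))) [SFinite volU]
    [volU.IsMulLeftInvariant] (volP : Measure (Edge d L → suAlg N)) [SFinite volP]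
    [volP.IsAddRightInvariant]
    {S : GaugeConfig d L (Matrix.specialUnitaryGroup (Fin N) ℂ) → ℝ} (hS : Measurable S)
    {T : (Edge d L → suAlg N) → ℝ} (hT : Measurable T) (δ : ℝ)
    {g : GaugeConfig d L (Matrix.specialUnitaryGroup (Fin N) ℂ) → (Edge d L → suAlg N)}
    (hg : Measurable g) (n : ℕ)
    (hZ0 : volP.withDensity (fun π => ENNReal.ofReal (Real.exp (-T π))) Set.univ ≠ 0)
    (hZtop : volP.withDensity (fun π => ENNReal.ofReal (Real.exp (-T π))) Set.univ ≠ ∞) (h : ℝ) :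
    (MD.boltz volU S ⊗ₘ
        Exactness.refreshUpdate
          (Exactness.involMH
            (⇑((Exactness.flip : Equiv.Perm (GaugeConfig d L (Matrix.specialUnitaryGroup (Fin N) ℂ) ×
                (Edge d L → suAlg N))) * Exactness.leapfrog (Exactness.mulDrift (halfExp δ)) g ^ n))
            (Exactness.measurable_flip_leapfrog_pow
              (Exactness.measurable_mulDrift (measurable_halfExp δ)) hg n)
            fun z : GaugeConfig d L (Matrix.specialUnitaryGroup (Fin N) ℂ) × (Edge d L → suAlg N) =>
              S z.1 + T z.2)
          ((volP.withDensity (fun π => ENNReal.ofReal (Real.exp (-T π))) Set.univ)⁻¹ •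
            volP.withDensity fun π => ENNReal.ofReal (Real.exp (-T π))))
      {q | Q q.1 ≠ Q q.2} ≤
      (volP.withDensity (fun π => ENNReal.ofReal (Real.exp (-T π))) Set.univ)⁻¹ *
        ∑ k ∈ Finset.range (3 * n),
          (ENNReal.ofReal (Real.exp h) *
              MD.boltz (volU.prod volP) (fun z => S z.1 + T z.2)
                {z | ∃ (x : Site d L) (μ ν : Fin d),
                  ε - |δ / 2| * (‖lfField k z (x, μ)‖ + ‖lfField k z (x.shift μ, ν)‖ +
                    ‖lfField k z (x.shift ν, μ)‖ + ‖lfField k z (x, ν)‖) ≤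
                      dist (plaquetteHolonomy z.1 x μ ν) 1} +
            MD.boltz (volU.prod volP) (fun z => S z.1 + T z.2)
              {z | h < (S (MD.nodes (MD.lfStep (Exactness.mulDrift (halfExp δ)) g) k z).1 +
                  T (MD.nodes (MD.lfStep (Exactness.mulDrift (halfExp δ)) g) k z).2) -
                (S z.1 + T z.2)}) :=
  sun_hmc_sectorCharge_ne_le_sum hA hQ hQA volU volP hS hT
    (fun k => MD.measurePreserving_lfStep (Exactness.measurable_mulDrift (measurable_halfExp δ))
      (Exactness.measurePreserving_mulDrift (halfExp δ)) hg k)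
    (fun _ => δ / 2) (fun k => measurable_lfField k) (lfStep_halfExp_fst δ g)
    (flip := ⇑(Exactness.flip : Equiv.Perm (GaugeConfig d L (Matrix.specialUnitaryGroup (Fin N) ℂ) ×
      (Edge d L → suAlg N))))
    (fun _ => rfl) (3 * n) _
    (fun z => by rw [Equiv.Perm.coe_mul, MD.coe_leapfrog_pow_eq_nodes]; rfl) hZ0 hZtop h

/-- **… AND IT IS EXACT**: with `volP` also negation-invariant, the configuration chain — refresh
`π ∼ Z_T⁻¹e^{-T}volP`, propose `flip ∘ leapfrog^n`, Metropolis, forget `π` — leaves `e^{-S}volU`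
invariant, for every step size, trajectory length, measurable action and force. [folklore] -/
theorem sun_leapfrogHMC_exact
    (volU : Measure (GaugeConfig d L (Matrix.specialUnitaryGroup (Fin N) ℂ))) [SFinite volU]
    [volU.IsMulLeftInvariant] (volP : Measure (Edge d L → suAlg N)) [SFinite volP]
    [volP.IsAddRightInvariant] [volP.IsNegInvariant]
    {S : GaugeConfig d L (Matrix.specialUnitaryGroup (Fin N) ℂ) → ℝ} (hS : Measurable S)
    {T : (Edge d L → suAlg N) → ℝ} (hT : Measurable T) (δ : ℝ)
    {g : GaugeConfig d L (Matrix.specialUnitaryGroup (Fin N) ℂ) → (Edge d L → suAlg N)}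
    (hg : Measurable g) (n : ℕ)
    (hZ0 : volP.withDensity (fun π => ENNReal.ofReal (Real.exp (-T π))) Set.univ ≠ 0)
    (hZtop : volP.withDensity (fun π => ENNReal.ofReal (Real.exp (-T π))) Set.univ ≠ ∞) :
    Kernel.Invariant
      (Exactness.refreshUpdate
        (Exactness.involMH
          (⇑((Exactness.flip : Equiv.Perm (GaugeConfig d L (Matrix.specialUnitaryGroup (Fin N) ℂ) ×
              (Edge d L → suAlg N))) * Exactness.leapfrog (Exactness.mulDrift (halfExp δ)) g ^ n))
          (Exactness.measurable_flip_leapfrog_pow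
            (Exactness.measurable_mulDrift (measurable_halfExp δ)) hg n)
          fun z : GaugeConfig d L (Matrix.specialUnitaryGroup (Fin N) ℂ) × (Edge d L → suAlg N) =>
            S z.1 + T z.2)
        ((volP.withDensity (fun π => ENNReal.ofReal (Real.exp (-T π))) Set.univ)⁻¹ •
          volP.withDensity fun π => ENNReal.ofReal (Real.exp (-T π))))
      (MD.boltz volU S) :=
  Exactness.hmc_config_exact hS hT
    (Exactness.leapfrog_pow_isFlipReversible (Exactness.mulDrift_reversal (halfExp_neg δ)) g n).involutive
    (by
      rw [Equiv.Perm.coe_mul]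
      exact Exactness.measurePreserving_flip.comp (Exactness.measurePreserving_perm_pow
        (Exactness.measurePreserving_leapfrog (Exactness.measurable_mulDrift (measurable_halfExp δ))
          (Exactness.measurePreserving_mulDrift (halfExp δ)) hg) n))
    hZ0 hZtop

end Law

end Summit.Ventures.LatticeQCDFlow.Theory2.Lattice.SUN

end
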